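import Summits.QuantumFields.YangMills.Theorems.UnitScaleTiltProp7Growth142T3ChartELStat
import Summits.QuantumFields.YangMills.Theorems.UnitScaleTiltProp7Taylor3ActionUniform
import HarnessLib

/-!
# Route `UnitScaleTilt`, crux K1 child «MinimiserStabilityRegPr» (stmt-QuantumFields-19200) — THE α-P LANE DOOR RESHAPED TO ONE JOINT ROW:
# «scale-aware Taylor ∧ EL ⟹ `A(W) ≤ A(e^{iD}W)` from the single inequality `e·ℓ⁻³·Σ_b‖iD(b) − ξ(b)‖ + (15552s² + 216·regThreshold(e))·Σ‖D‖² ≤ ¼·Σ_p‖ℒ_p(D)‖²`»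
# (both forms: R2-critical background for E′, E–L-critical chart point for EX) and ★ `stub_PV3E_of_jointRows` (the E′ text verbatim, NO `L`-only window)

Cell `ym3-torus`, width seat `ym-ust-19200-w4` (gen 4).  THEOREMS ONLY (0 `def`, 0 `sorry`).  YM₃ on T³ is a ladder rung (R3), not the Clay problem; nothing here
claims the stub, the crux, d = 4 or the mass gap.

WHY (located 2026-08-28 12:41Z, bus).  ✓`Prop7LocMinOfSliceRows.wilsonAction4_le_expChart_of_sliceRows_stat` ∕ ✓`PV3ESigmaUniform.isMinOn_regFibrePr_of_sliceRows_at` consume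
NORMAL_W `Σ_b‖iD(b) − ξ(b)‖ ≤ c_N·Σ‖D‖²` and HESS_W′ `κ·Σ‖D‖² ≤ Σ_p‖ℒ_p(D)‖²` with SEPARATE constants and the window `15552s² + 216·regThreshold(e) + e·ℓ⁻³·c_N ≤ κ∕4`
(`ℓ = L^{K−n}`).  That is a product of two worst cases the mathematics does not pay jointly: the worst-HESS directions (smooth `D`, `ℒ_p(D) ≈ 0`, `κ ~ ℓ⁻²`) have a
SMALL averaging defect, the worst-defect directions (coherent along an averaging contour) have `Σ_p‖ℒ_p(D)‖² ≈ 4Σ‖D‖²`; and the fibre-curve corrector the tree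
owns (✓`Prop8Criticality.exists_iter_lift_curve`, single `centralBond` lineage, one-step cost `2η ∕ emlWeight`, ✓`emlWeight_T3 = (36L³)⁻¹`) delivers `c_N` of order
`ℓ³·(‖Q_W(iD)‖₁ ∕ Σ‖D‖²)`, far outside `c_N ≤ c₀·ℓ`.  The proofs of the two ✓ doors, however, use ONLY the combination displayed here.  So this file re-cuts the
door at exactly what is consumed: ONE JOINT ROW per competitor direction, with the direction's own sup-radius `s` (`4s ≤ 1`), and NO window at all — the E′
text follows with `e₅ := e₆`, `a₁'' := 1` from rows stated member by member (★ `stub_PV3E_of_jointRows`); `jointRow_of_sliceRows` records that the old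
triple implies the new row, so every ✓ supplier shape still fits.

WHAT IS PROVED (ns `…Theorems.Prop7LocMinOfJointRow`).  `jointRow_of_sliceRows` (old triple ⟹ joint row) · ★★ `isMinOn_regFibrePr_of_jointRows_at` (E′ at a
datum: R2-critical `W ∈ (6)(e) ∩ 𝔅_k(V)`, every competitor carries `(D, γ, ξ, s)` with the Σ_k-curve clause of ✓`Prop7Growth142T3ChartELCurrent` and the
joint row ⟹ `W` minimises over (6)(e)) · ★★ `wilsonAction4_le_expChart_of_jointRow_stat` (EX form: E–L clause over `𝔅_k(V)` + gauge lift `u`, as in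
✓`Prop7LocMinOfSliceRows`) · ★★★ `stub_PV3E_of_jointRows` (conclusion = the E′ text of `PV3E.stub_PV3E` verbatim) · §4 the Lin-LEVEL SOCKET: ★★ `wilsonAction4_le_expChart_of_linRow` (Taylor only:
`|ℓ_W(D)| + (15552s² + 216·regThreshold(e))·Σ‖D‖² ≤ ¼·Σ_p‖ℒ_p(D)‖² ⟹ A(W) ≤ A(e^{iD}W)`, no criticality), ★★ `isMinOn_regFibrePr_of_linRows_at`, and the bookkeeping
★★ `linRow_of_QRows` (★p1-19200 g13 (c): `|ℓ_W(D)| ≤ 2ε₀ℓ⁻¹R` ∧ `R ≤ C₁ℓ⁻¹Σ‖D‖² + C₂ℓΣ_p‖ℒ_p D‖²` ∧ HESS_W′ ∧ an `L`-only window ⟹ the Lin-level row).  EL and Taylor are THEOREMS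
(`abs_lin_chart_le_of_sigmaVelocity_current`, `abs_lin_chart_le_of_fibreEL_current`, `wilsonAction4_expChart_sub_lin_ge` at `θ = ½`).

HONEST SCOPE.  Bookkeeping: the joint row is displayed, nothing of print asserted; whether it is inhabited `k`-uniformly is (142)'s content (the Hessian of
the Lagrangian `A − ⟨λ, Avg⟩` on `ker Q_W`), open in the tree.  `--supports stmt-QuantumFields-19200`, count-neutral.

References: T. Bałaban, CMP 102 (1985) 277–309 [Balaban1985Variational] ((2), (4)–(7) p.278, (14) p.280, (19) p.281, (47)–(48) pp.285–286, (116) p.295, (127) p.297,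
(141)–(142), Prop. 7 p.299); CMP 99 (1985) 75–102 [Balaban1985RegularSpaces] ((1.28)–(1.31) pp.80–82, Thm 2 p.83).
-/

set_option autoImplicit false
noncomputable section

open scoped BigOperators Matrix.Norms.L2Operator Matrix Topology
open Filter

namespace Summit.QuantumFields.YangMills.Theorems.Prop7LocMinOfJointRow

open Literature.MathematicalPhysics.QuantumFieldTheory.Balaban1983to89
open Literature.MathematicalPhysics.QuantumFieldTheory.Balaban1983to89.T3ContinuumYM3Torus
open Literature.MathematicalPhysics.QuantumFieldTheory.Balaban1983to89.T3UnitLawDensityEML (ℰp)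
open Literature.MathematicalPhysics.QuantumFieldTheory.Balaban1983to89.T3ConstrainedMinimiser
open Literature.MathematicalPhysics.QuantumFieldTheory.Balaban1983to89.T3Thm1Carrier
open Literature.MathematicalPhysics.QuantumFieldTheory.Balaban1983to89.T3PrintedRegularMinimiser
open Literature.MathematicalPhysics.QuantumFieldTheory.Balaban1983to89.T3RegularMinimiser
open Literature.MathematicalPhysics.QuantumFieldTheory.Balaban1983to89.T3Thm1CarrierNative (IsCritR2)
open Literature.MathematicalPhysics.QuantumFieldTheory.Balaban1983to89.T3SectALandauChart (emb15 CloseAvg pos_of_regPr)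
open Summit.QuantumFields.YangMills.Theorems.Prop7TPrint (expHermField)
open Summit.QuantumFields.YangMills.Theorems.Prop7Taylor3Uniform (wilsonAction4_expChart_sub_lin_ge)
open Summit.QuantumFields.YangMills.Theorems.Prop7Growth142T3ChartELCurrent (abs_lin_chart_le_of_sigmaVelocity_current)
open Summit.QuantumFields.YangMills.Theorems.Prop7Growth142T3ChartELStat (abs_lin_chart_le_of_fibreEL_current)

variable (F : T3Family) {n K : ℕ}

/-! ## §0 The old triple implies the joint row -/

/-- NORMAL_W with constant `c_N`, HESS_W′ with constant `κ` and the window `15552s² + 216·regThreshold(e) + e·ℓ⁻³·c_N ≤ κ∕4` imply the joint row (so every supplier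
of the ✓ slice-row doors supplies this door). [cite: Balaban1985Variational, (47)-(48) pp.285-286, (116) p.295, (141)-(142) p.299] -/
theorem jointRow_of_sliceRows {e s cN κ : ℝ} (he : 0 ≤ e) (W : GaugeField (F.P K) 0 (Matrix.specialUnitaryGroup (Fin 2) ℂ))
    (D ξ : PBond (F.P K) 0 → Matrix (Fin 2) (Fin 2) ℂ)
    (hN : ∑ b : PBond (F.P K) 0, ‖Complex.I • D b - ξ b‖ ≤ cN * ∑ b : PBond (F.P K) 0, ‖D b‖ ^ 2)
    (hq : κ * ∑ b : PBond (F.P K) 0, ‖D b‖ ^ 2 ≤ ∑ p : Plaq (F.P K) 0, ‖((Complex.I • D ⟨p.src, p.μ⟩) + ((W ⟨p.src, p.μ⟩ : Matrix (Fin 2) (Fin 2) ℂ) * (Complex.I • D ⟨p.src.shift p.μ, p.ν⟩) * star (W ⟨p.src, p.μ⟩ : Matrix (Fin 2) (Fin 2) ℂ))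
            - (((W ⟨p.src, p.μ⟩ * W ⟨p.src.shift p.μ, p.ν⟩ * (W ⟨p.src.shift p.ν, p.μ⟩)⁻¹ : Matrix.specialUnitaryGroup (Fin 2) ℂ) : Matrix (Fin 2) (Fin 2) ℂ) * (Complex.I • D ⟨p.src.shift p.ν, p.μ⟩) * star ((W ⟨p.src, p.μ⟩ * W ⟨p.src.shift p.μ, p.ν⟩ * (W ⟨p.src.shift p.ν, p.μ⟩)⁻¹ : Matrix.specialUnitaryGroup (Fin 2) ℂ) : Matrix (Fin 2) (Fin 2) ℂ))
            - (((GaugeField.plaqHol W p : Matrix.specialUnitaryGroup (Fin 2) ℂ) : Matrix (Fin 2) (Fin 2) ℂ) * (Complex.I • D ⟨p.src, p.ν⟩) * star ((GaugeField.plaqHol W p : Matrix.specialUnitaryGroup (Fin 2) ℂ) : Matrix (Fin 2) (Fin 2) ℂ)))‖ ^ 2)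
    (hsmall : 15552 * s ^ 2 + 216 * regThreshold F n K e + e * (((F.L : ℝ) ^ (K - n)) ^ 3)⁻¹ * cN ≤ κ / 4) :
    e * (((F.L : ℝ) ^ (K - n)) ^ 3)⁻¹ * ∑ b : PBond (F.P K) 0, ‖Complex.I • D b - ξ b‖
              + (15552 * s ^ 2 + 216 * regThreshold F n K e) * ∑ b : PBond (F.P K) 0, ‖D b‖ ^ 2
            ≤ 1 / 4 * ∑ p : Plaq (F.P K) 0, ‖((Complex.I • D ⟨p.src, p.μ⟩) + ((W ⟨p.src, p.μ⟩ : Matrix (Fin 2) (Fin 2) ℂ) * (Complex.I • D ⟨p.src.shift p.μ, p.ν⟩) * star (W ⟨p.src, p.μ⟩ : Matrix (Fin 2) (Fin 2) ℂ))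
            - (((W ⟨p.src, p.μ⟩ * W ⟨p.src.shift p.μ, p.ν⟩ * (W ⟨p.src.shift p.ν, p.μ⟩)⁻¹ : Matrix.specialUnitaryGroup (Fin 2) ℂ) : Matrix (Fin 2) (Fin 2) ℂ) * (Complex.I • D ⟨p.src.shift p.ν, p.μ⟩) * star ((W ⟨p.src, p.μ⟩ * W ⟨p.src.shift p.μ, p.ν⟩ * (W ⟨p.src.shift p.ν, p.μ⟩)⁻¹ : Matrix.specialUnitaryGroup (Fin 2) ℂ) : Matrix (Fin 2) (Fin 2) ℂ))
            - (((GaugeField.plaqHol W p : Matrix.specialUnitaryGroup (Fin 2) ℂ) : Matrix (Fin 2) (Fin 2) ℂ) * (Complex.I • D ⟨p.src, p.ν⟩) * star ((GaugeField.plaqHol W p : Matrix.specialUnitaryGroup (Fin 2) ℂ) : Matrix (Fin 2) (Fin 2) ℂ)))‖ ^ 2 := by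
  have hj0 : 0 ≤ e * (((F.L : ℝ) ^ (K - n)) ^ 3)⁻¹ := by positivity
  have hS0 : 0 ≤ ∑ b : PBond (F.P K) 0, ‖D b‖ ^ 2 := Finset.sum_nonneg fun _ _ => sq_nonneg _
  have h1 : e * (((F.L : ℝ) ^ (K - n)) ^ 3)⁻¹ * ∑ b : PBond (F.P K) 0, ‖Complex.I • D b - ξ b‖
      ≤ e * (((F.L : ℝ) ^ (K - n)) ^ 3)⁻¹ * (cN * ∑ b : PBond (F.P K) 0, ‖D b‖ ^ 2) := mul_le_mul_of_nonneg_left hN hj0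
  have h3 : 0 ≤ (κ / 4 - 15552 * s ^ 2 - 216 * regThreshold F n K e - e * (((F.L : ℝ) ^ (K - n)) ^ 3)⁻¹ * cN)
      * ∑ b : PBond (F.P K) 0, ‖D b‖ ^ 2 := mul_nonneg (by linarith) hS0
  nlinarith [h1, h3, hq]

/-! ## §1 E′ at a datum from the joint rows (R2-critical background) -/

/-- ★★ **E′ AT A DATUM FROM CHART_W^Σ ∧ THE JOINT ROW.**  `W ∈ (6)(e) ∩ 𝔅_k(V)` R2-critical; every competitor `W′ ∈ (6)(e) ∩ 𝔅_k(V)` comes with a Hermitian-traceless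
`D` of sup-radius `s`, `4s ≤ 1`, `A(W′) = A(e^{iD}W)`, a Σ_k-curve `γ` through `W` (continuous at `0`, gauge-equivalent to a fibre point for small `t`) with bond
velocities `ξ`, and the joint row `e·ℓ⁻³·Σ_b‖iD(b) − ξ(b)‖ + (15552s² + 216·regThreshold(e))·Σ‖D‖² ≤ ¼·Σ_p‖ℒ_p(D)‖²`.  Then `W` minimises the Wilson action over
(6)(e).  Proof: Taylor at `θ = ½` (✓`wilsonAction4_expChart_sub_lin_ge`) + (141) at the current rate (✓`abs_lin_chart_le_of_sigmaVelocity_current`).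
[cite: Balaban1985Variational, (141)-(142) p.299, (47)-(48) pp.285-286, (116) p.295, (6) p.278] -/
theorem isMinOn_regFibrePr_of_jointRows_at (h : n ≤ K) {e : ℝ}
    (V : GaugeField (F.P n) 0 (Matrix.specialUnitaryGroup (Fin 2) ℂ)) {W : GaugeField (F.P K) 0 (Matrix.specialUnitaryGroup (Fin 2) ℂ)}
    (hW : IsCritR2 F n K h V W) (hWe : W ∈ regFibrePr F n K h e V)
    (hrows : ∀ W' : GaugeField (F.P K) 0 (Matrix.specialUnitaryGroup (Fin 2) ℂ), W' ∈ regFibrePr F n K h e V →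
        ∃ (D : PBond (F.P K) 0 → Matrix (Fin 2) (Fin 2) ℂ) (γ : ℝ → GaugeField (F.P K) 0 (Matrix.specialUnitaryGroup (Fin 2) ℂ)) (ξ : PBond (F.P K) 0 → Matrix (Fin 2) (Fin 2) ℂ) (s : ℝ),
          (∀ b : PBond (F.P K) 0, (D b).IsHermitian ∧ Matrix.trace (D b) = 0) ∧ (∀ b : PBond (F.P K) 0, ‖D b‖ ≤ s) ∧ 4 * s ≤ 1 ∧
          wilsonAction4 W' = wilsonAction4 (emb15 W (expHermField D)) ∧
          γ 0 = W ∧ ContinuousAt γ 0 ∧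
          (∀ᶠ t in 𝓝 (0 : ℝ), ∃ u : GaugeTransf (F.P K) 0 (Matrix.specialUnitaryGroup (Fin 2) ℂ), GaugeField.gaugeAct u (γ t) ∈ fibre F ℰp n K h V) ∧
          (∀ b : PBond (F.P K) 0, HasDerivAt (fun t : ℝ => (γ t b : Matrix (Fin 2) (Fin 2) ℂ) * star (W b : Matrix (Fin 2) (Fin 2) ℂ)) (ξ b) 0) ∧
          e * (((F.L : ℝ) ^ (K - n)) ^ 3)⁻¹ * ∑ b : PBond (F.P K) 0, ‖Complex.I • D b - ξ b‖
              + (15552 * s ^ 2 + 216 * regThreshold F n K e) * ∑ b : PBond (F.P K) 0, ‖D b‖ ^ 2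
            ≤ 1 / 4 * ∑ p : Plaq (F.P K) 0, ‖((Complex.I • D ⟨p.src, p.μ⟩) + ((W ⟨p.src, p.μ⟩ : Matrix (Fin 2) (Fin 2) ℂ) * (Complex.I • D ⟨p.src.shift p.μ, p.ν⟩) * star (W ⟨p.src, p.μ⟩ : Matrix (Fin 2) (Fin 2) ℂ))
            - (((W ⟨p.src, p.μ⟩ * W ⟨p.src.shift p.μ, p.ν⟩ * (W ⟨p.src.shift p.ν, p.μ⟩)⁻¹ : Matrix.specialUnitaryGroup (Fin 2) ℂ) : Matrix (Fin 2) (Fin 2) ℂ) * (Complex.I • D ⟨p.src.shift p.ν, p.μ⟩) * star ((W ⟨p.src, p.μ⟩ * W ⟨p.src.shift p.μ, p.ν⟩ * (W ⟨p.src.shift p.ν, p.μ⟩)⁻¹ : Matrix.specialUnitaryGroup (Fin 2) ℂ) : Matrix (Fin 2) (Fin 2) ℂ))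
            - (((GaugeField.plaqHol W p : Matrix.specialUnitaryGroup (Fin 2) ℂ) : Matrix (Fin 2) (Fin 2) ℂ) * (Complex.I • D ⟨p.src, p.ν⟩) * star ((GaugeField.plaqHol W p : Matrix.specialUnitaryGroup (Fin 2) ℂ) : Matrix (Fin 2) (Fin 2) ℂ)))‖ ^ 2) :
    IsMinOn (fun W' : GaugeField (F.P K) 0 (Matrix.specialUnitaryGroup (Fin 2) ℂ) => wilsonAction4 W') (regFibrePr F n K h e V) W := by
  intro W' hW'
  obtain ⟨D, γ, ξ, s, hDh, hDs, hs4, hA, hγ0, hγc, hγfib, hγξ, hJ⟩ := hrows W' hW'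
  show wilsonAction4 W ≤ wilsonAction4 W'
  rw [hA]
  have hreg : RegPr F n K e W := ((mem_regFibrePr_iff F).mp hWe).2
  have he0 : 0 < e := pos_of_regPr F hreg
  have hthr0 : 0 ≤ regThreshold F n K e := by unfold regThreshold; positivity
  have ha : ∀ p : Plaq (F.P K) 0, ‖((GaugeField.plaqHol W p : Matrix.specialUnitaryGroup (Fin 2) ℂ) : Matrix (Fin 2) (Fin 2) ℂ) - 1‖ ≤ regThreshold F n K e := fun p => by
    have hp := hreg.1 p
    rw [SU2Mean.dist1_eq_norm] at hp
    exact hp.le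
  have hT := wilsonAction4_expChart_sub_lin_ge W D hDh hDs hs4 hthr0 ha (θ := 1 / 2) (by norm_num) (by norm_num)
  rw [show ((1 : ℝ) - 1 / 2) / 2 = 1 / 4 by norm_num, show (7776 : ℝ) * (1 / 2)⁻¹ = 15552 by norm_num] at hT
  have hEL := abs_lin_chart_le_of_sigmaVelocity_current hW hWe D γ hγ0 hγc hγfib ξ hγξ
  have habs := (abs_le.mp hEL).1
  linarith [hT, habs, hJ]

/-! ## §2 The EX form: E–L-critical chart point, gauge-lifted curves -/

/-- ★★ **LOCMIN_W FROM THE JOINT ROW, STATIONARITY FORM.**  At `W ∈ 𝔘_k(e)` satisfying the EX knit's E–L clause over `𝔅_k(V)`, for a set `T` of directions each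
carrying: Hermitian-traceless `D` of sup-radius `s` with `4s ≤ 1`; a curve `γ` through `W` with bond velocities `ξ` and a differentiable gauge lift `u` into
`𝔅_k(V)` (`u(0) = 1`); and the joint row — `A(W) ≤ A(e^{iD}W)` for every `D ∈ T`.  Proof: Taylor at `θ = ½` + ✓`abs_lin_chart_le_of_fibreEL_current`.
[cite: Balaban1985Variational, (141)-(142) p.299, (47)-(48) pp.285-286, (116) p.295, (2), (6) p.278; Balaban1985RegularSpaces, Thm 2 p.83] -/
theorem wilsonAction4_le_expChart_of_jointRow_stat (h : n ≤ K) {e : ℝ}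
    (V : GaugeField (F.P n) 0 (Matrix.specialUnitaryGroup (Fin 2) ℂ)) {W : GaugeField (F.P K) 0 (Matrix.specialUnitaryGroup (Fin 2) ℂ)}
    (hEL : ∀ φ : ℝ → GaugeField (F.P K) 0 (Matrix.specialUnitaryGroup (Fin 2) ℂ), φ 0 = W → (∀ t, φ t ∈ fibre F ℰp n K h V) →
      (∀ b : PBond (F.P K) 0, DifferentiableAt ℝ (fun t => ((φ t b : Matrix.specialUnitaryGroup (Fin 2) ℂ) : Matrix (Fin 2) (Fin 2) ℂ)) 0) →
        deriv (fun t => wilsonAction4 (φ t)) 0 = 0)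
    (hreg : RegPr F n K e W) (T : Set (PBond (F.P K) 0 → Matrix (Fin 2) (Fin 2) ℂ))
    (hrows : ∀ D ∈ T, (∀ b : PBond (F.P K) 0, (D b).IsHermitian ∧ Matrix.trace (D b) = 0) ∧
      ∃ (s : ℝ) (γ : ℝ → GaugeField (F.P K) 0 (Matrix.specialUnitaryGroup (Fin 2) ℂ)) (ξ : PBond (F.P K) 0 → Matrix (Fin 2) (Fin 2) ℂ) (u : ℝ → GaugeTransf (F.P K) 0 (Matrix.specialUnitaryGroup (Fin 2) ℂ)),
        (∀ b : PBond (F.P K) 0, ‖D b‖ ≤ s) ∧ 4 * s ≤ 1 ∧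
        γ 0 = W ∧ (∀ b : PBond (F.P K) 0, HasDerivAt (fun t : ℝ => (γ t b : Matrix (Fin 2) (Fin 2) ℂ) * star (W b : Matrix (Fin 2) (Fin 2) ℂ)) (ξ b) 0) ∧
        u 0 = (fun _ => 1) ∧ (∀ t, GaugeField.gaugeAct (u t) (γ t) ∈ fibre F ℰp n K h V) ∧
        (∀ b : PBond (F.P K) 0, DifferentiableAt ℝ (fun t => ((GaugeField.gaugeAct (u t) (γ t) b : Matrix.specialUnitaryGroup (Fin 2) ℂ) : Matrix (Fin 2) (Fin 2) ℂ)) 0) ∧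
        e * (((F.L : ℝ) ^ (K - n)) ^ 3)⁻¹ * ∑ b : PBond (F.P K) 0, ‖Complex.I • D b - ξ b‖
              + (15552 * s ^ 2 + 216 * regThreshold F n K e) * ∑ b : PBond (F.P K) 0, ‖D b‖ ^ 2
            ≤ 1 / 4 * ∑ p : Plaq (F.P K) 0, ‖((Complex.I • D ⟨p.src, p.μ⟩) + ((W ⟨p.src, p.μ⟩ : Matrix (Fin 2) (Fin 2) ℂ) * (Complex.I • D ⟨p.src.shift p.μ, p.ν⟩) * star (W ⟨p.src, p.μ⟩ : Matrix (Fin 2) (Fin 2) ℂ))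
            - (((W ⟨p.src, p.μ⟩ * W ⟨p.src.shift p.μ, p.ν⟩ * (W ⟨p.src.shift p.ν, p.μ⟩)⁻¹ : Matrix.specialUnitaryGroup (Fin 2) ℂ) : Matrix (Fin 2) (Fin 2) ℂ) * (Complex.I • D ⟨p.src.shift p.ν, p.μ⟩) * star ((W ⟨p.src, p.μ⟩ * W ⟨p.src.shift p.μ, p.ν⟩ * (W ⟨p.src.shift p.ν, p.μ⟩)⁻¹ : Matrix.specialUnitaryGroup (Fin 2) ℂ) : Matrix (Fin 2) (Fin 2) ℂ))
            - (((GaugeField.plaqHol W p : Matrix.specialUnitaryGroup (Fin 2) ℂ) : Matrix (Fin 2) (Fin 2) ℂ) * (Complex.I • D ⟨p.src, p.ν⟩) * star ((GaugeField.plaqHol W p : Matrix.specialUnitaryGroup (Fin 2) ℂ) : Matrix (Fin 2) (Fin 2) ℂ)))‖ ^ 2) :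
    ∀ D ∈ T, wilsonAction4 W ≤ wilsonAction4 (emb15 W (expHermField D)) := by
  intro D hDT
  obtain ⟨hDh, s, γ, ξ, u, hDs, hs4, hγ0, hγξ, hu0, hufib, hudiff, hJ⟩ := hrows D hDT
  have he0 : 0 < e := pos_of_regPr F hreg
  have hthr0 : 0 ≤ regThreshold F n K e := by unfold regThreshold; positivity
  have ha : ∀ p : Plaq (F.P K) 0, ‖((GaugeField.plaqHol W p : Matrix.specialUnitaryGroup (Fin 2) ℂ) : Matrix (Fin 2) (Fin 2) ℂ) - 1‖ ≤ regThreshold F n K e := fun p => by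
    have hp := hreg.1 p
    rw [SU2Mean.dist1_eq_norm] at hp
    exact hp.le
  have hT := wilsonAction4_expChart_sub_lin_ge W D hDh hDs hs4 hthr0 ha (θ := 1 / 2) (by norm_num) (by norm_num)
  rw [show ((1 : ℝ) - 1 / 2) / 2 = 1 / 4 by norm_num, show (7776 : ℝ) * (1 / 2)⁻¹ = 15552 by norm_num] at hT
  have hELb := abs_lin_chart_le_of_fibreEL_current hEL hreg.2 D γ hγ0 ξ hγξ u hu0 hufib hudiff
  have habs := (abs_le.mp hELb).1
  linarith [hT, habs, hJ]

/-! ## §3 The E′ text of record from the joint rows, member by member — no `L`-only window -/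

/-- ★★★ **ROW E′ OF SKELETON v9∕v10 (OWNER RULING g24-№3; [Balaban1985Variational] (141)–(142) in print's regime) FROM THE JOINT ROWS.**  For every `L > 1` a radius
`e₆ > 0` such that at every member `(F, n, K)` with `F.L = L`, every `0 < e ≤ e₆`, every datum `V` and every R2-critical `W ∈ (6)(e) ∩ 𝔅_k(V)`, every competitor
carries `(D, γ, ξ, s)` as in `isMinOn_regFibrePr_of_jointRows_at`.  CONCLUSION = the E′ text verbatim (`e₅ := e₆`, `a₁'' := 1`).  No window, no pinned
representative; (141) and Taylor are theorems. [cite: Balaban1985Variational, (141)-(142) p.299, Prop. 7 p.299, (4)-(7) p.278, (14) p.280, (19) p.281, (47)-(48) pp.285-286, (116) p.295] -/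
theorem stub_PV3E_of_jointRows
    (hrowsJ : ∀ (L : ℕ), 1 < L → ∃ e₆ : ℝ, 0 < e₆ ∧
      ∀ (F : T3Family), F.L = L → ∀ (n K : ℕ) (hnK : n < K) (e : ℝ) (V : GaugeField (F.P n) 0 (Matrix.specialUnitaryGroup (Fin 2) ℂ))
        (W : GaugeField (F.P K) 0 (Matrix.specialUnitaryGroup (Fin 2) ℂ)),
        0 < e → e ≤ e₆ → W ∈ regFibrePr F n K hnK.le e V → IsCritR2 F n K hnK.le V W →
        ∀ W' : GaugeField (F.P K) 0 (Matrix.specialUnitaryGroup (Fin 2) ℂ), W' ∈ regFibrePr F n K hnK.le e V →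
          ∃ (D : PBond (F.P K) 0 → Matrix (Fin 2) (Fin 2) ℂ) (γ : ℝ → GaugeField (F.P K) 0 (Matrix.specialUnitaryGroup (Fin 2) ℂ)) (ξ : PBond (F.P K) 0 → Matrix (Fin 2) (Fin 2) ℂ) (s : ℝ),
            (∀ b : PBond (F.P K) 0, (D b).IsHermitian ∧ Matrix.trace (D b) = 0) ∧ (∀ b : PBond (F.P K) 0, ‖D b‖ ≤ s) ∧ 4 * s ≤ 1 ∧
            wilsonAction4 W' = wilsonAction4 (emb15 W (expHermField D)) ∧
            γ 0 = W ∧ ContinuousAt γ 0 ∧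
            (∀ᶠ t in 𝓝 (0 : ℝ), ∃ u : GaugeTransf (F.P K) 0 (Matrix.specialUnitaryGroup (Fin 2) ℂ), GaugeField.gaugeAct u (γ t) ∈ fibre F ℰp n K hnK.le V) ∧
            (∀ b : PBond (F.P K) 0, HasDerivAt (fun t : ℝ => (γ t b : Matrix (Fin 2) (Fin 2) ℂ) * star (W b : Matrix (Fin 2) (Fin 2) ℂ)) (ξ b) 0) ∧
            e * (((F.L : ℝ) ^ (K - n)) ^ 3)⁻¹ * ∑ b : PBond (F.P K) 0, ‖Complex.I • D b - ξ b‖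
              + (15552 * s ^ 2 + 216 * regThreshold F n K e) * ∑ b : PBond (F.P K) 0, ‖D b‖ ^ 2
            ≤ 1 / 4 * ∑ p : Plaq (F.P K) 0, ‖((Complex.I • D ⟨p.src, p.μ⟩) + ((W ⟨p.src, p.μ⟩ : Matrix (Fin 2) (Fin 2) ℂ) * (Complex.I • D ⟨p.src.shift p.μ, p.ν⟩) * star (W ⟨p.src, p.μ⟩ : Matrix (Fin 2) (Fin 2) ℂ))
            - (((W ⟨p.src, p.μ⟩ * W ⟨p.src.shift p.μ, p.ν⟩ * (W ⟨p.src.shift p.ν, p.μ⟩)⁻¹ : Matrix.specialUnitaryGroup (Fin 2) ℂ) : Matrix (Fin 2) (Fin 2) ℂ) * (Complex.I • D ⟨p.src.shift p.ν, p.μ⟩) * star ((W ⟨p.src, p.μ⟩ * W ⟨p.src.shift p.μ, p.ν⟩ * (W ⟨p.src.shift p.ν, p.μ⟩)⁻¹ : Matrix.specialUnitaryGroup (Fin 2) ℂ) : Matrix (Fin 2) (Fin 2) ℂ))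
            - (((GaugeField.plaqHol W p : Matrix.specialUnitaryGroup (Fin 2) ℂ) : Matrix (Fin 2) (Fin 2) ℂ) * (Complex.I • D ⟨p.src, p.ν⟩) * star ((GaugeField.plaqHol W p : Matrix.specialUnitaryGroup (Fin 2) ℂ) : Matrix (Fin 2) (Fin 2) ℂ)))‖ ^ 2) :
    ∀ (L : ℕ), 1 < L → ∀ (B₃ : ℝ), 4 < B₃ →
    ∃ e₅ a₁'' : ℝ, 0 < e₅ ∧ 0 < a₁'' ∧ ∀ (i : Idx L) (e ε₁ : ℝ) (V : GaugeField (i.1.1.P i.1.2.1) 0 (Matrix.specialUnitaryGroup (Fin 2) ℂ))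
      (U₀ W : GaugeField (i.1.1.P i.1.2.2) 0 (Matrix.specialUnitaryGroup (Fin 2) ℂ)),
      0 < ε₁ → ε₁ ≤ a₁'' → PlaqSmall ε₁ V → (L : ℝ) ^ 3 * B₃ * ε₁ ≤ e → e ≤ e₅ →
      RegPr i.1.1 i.1.2.1 i.1.2.2 ((L : ℝ) ^ 3 * B₃ * ε₁) U₀ → CloseAvg i.1.1 i.1.2.1 i.1.2.2 i.2.2.le ((L : ℝ) ^ 3 * ε₁) V U₀ →
      W ∈ regFibrePr i.1.1 i.1.2.1 i.1.2.2 i.2.2.le e V → IsCritR2 i.1.1 i.1.2.1 i.1.2.2 i.2.2.le V W →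
        IsMinOn (fun W' : GaugeField (i.1.1.P i.1.2.2) 0 (Matrix.specialUnitaryGroup (Fin 2) ℂ) => wilsonAction4 W')
          (regFibrePr i.1.1 i.1.2.1 i.1.2.2 i.2.2.le e V) W := by
  intro L hL B₃ hB₃
  obtain ⟨e₆, he₆, H⟩ := hrowsJ L hL
  refine ⟨e₆, 1, he₆, one_pos, ?_⟩
  intro i e ε₁ V U₀ W hε₁ _hε₁a _hV hlo hhi _hRU₀ _hclose hW hWcrit
  obtain ⟨⟨F, n, K⟩, hF, hnK⟩ := i
  have hL0 : (0 : ℝ) < (L : ℝ) := by exact_mod_cast (show 0 < L by omega)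
  have he0 : 0 < e := lt_of_lt_of_le (by positivity) hlo
  exact isMinOn_regFibrePr_of_jointRows_at F hnK.le V hWcrit hW (H F hF n K hnK e V W he0 hhi hW hWcrit)

/-! ## §4 The Lin-level socket: Taylor alone, the first variation left to the supplier's currency -/

/-- ★★ **THE ACTION-LEVEL SOCKET (TAYLOR ONLY).**  For a Hermitian-traceless direction `D` of sup-radius `s` (`4s ≤ 1`) at any `W ∈ 𝔘_k(e)`: if the first variation
`ℓ_W(D)` satisfies `|ℓ_W(D)| + (15552s² + 216·regThreshold(e))·Σ‖D‖² ≤ ¼·Σ_p‖ℒ_p(D)‖²`, then `A(W) ≤ A(e^{iD}W)`.  No criticality is used here — bounding `|ℓ_W(D)|`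
(by (141) in the curve currency, ✓`Prop7Growth142T3ChartELStat`, or in the `Q`-currency, ✓`Prop7FirstVariationExactPairing.abs_lin_le_sum_norm_trueLinIter`) is the
supplier's business. [cite: Balaban1985Variational, (141)-(142) p.299, (116) p.295, (6) p.278] -/
theorem wilsonAction4_le_expChart_of_linRow {e s : ℝ} {W : GaugeField (F.P K) 0 (Matrix.specialUnitaryGroup (Fin 2) ℂ)} (hreg : RegPr F n K e W)
    (D : PBond (F.P K) 0 → Matrix (Fin 2) (Fin 2) ℂ) (hDh : ∀ b : PBond (F.P K) 0, (D b).IsHermitian ∧ Matrix.trace (D b) = 0)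
    (hDs : ∀ b : PBond (F.P K) 0, ‖D b‖ ≤ s) (hs4 : 4 * s ≤ 1)
    (hlin : |∑ p : Plaq (F.P K) 0, (1 / 2) * (((((GaugeField.plaqHol W p : Matrix.specialUnitaryGroup (Fin 2) ℂ) : Matrix (Fin 2) (Fin 2) ℂ) - 1)ᴴ * (((Complex.I • D ⟨p.src, p.μ⟩) + ((W ⟨p.src, p.μ⟩ : Matrix (Fin 2) (Fin 2) ℂ) * (Complex.I • D ⟨p.src.shift p.μ, p.ν⟩) * star (W ⟨p.src, p.μ⟩ : Matrix (Fin 2) (Fin 2) ℂ))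
            - (((W ⟨p.src, p.μ⟩ * W ⟨p.src.shift p.μ, p.ν⟩ * (W ⟨p.src.shift p.ν, p.μ⟩)⁻¹ : Matrix.specialUnitaryGroup (Fin 2) ℂ) : Matrix (Fin 2) (Fin 2) ℂ) * (Complex.I • D ⟨p.src.shift p.ν, p.μ⟩) * star ((W ⟨p.src, p.μ⟩ * W ⟨p.src.shift p.μ, p.ν⟩ * (W ⟨p.src.shift p.ν, p.μ⟩)⁻¹ : Matrix.specialUnitaryGroup (Fin 2) ℂ) : Matrix (Fin 2) (Fin 2) ℂ))
            - (((GaugeField.plaqHol W p : Matrix.specialUnitaryGroup (Fin 2) ℂ) : Matrix (Fin 2) (Fin 2) ℂ) * (Complex.I • D ⟨p.src, p.ν⟩) * star ((GaugeField.plaqHol W p : Matrix.specialUnitaryGroup (Fin 2) ℂ) : Matrix (Fin 2) (Fin 2) ℂ))) * ((GaugeField.plaqHol W p : Matrix.specialUnitaryGroup (Fin 2) ℂ) : Matrix (Fin 2) (Fin 2) ℂ))).trace).re|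
        + (15552 * s ^ 2 + 216 * regThreshold F n K e) * ∑ b : PBond (F.P K) 0, ‖D b‖ ^ 2
      ≤ 1 / 4 * ∑ p : Plaq (F.P K) 0, ‖((Complex.I • D ⟨p.src, p.μ⟩) + ((W ⟨p.src, p.μ⟩ : Matrix (Fin 2) (Fin 2) ℂ) * (Complex.I • D ⟨p.src.shift p.μ, p.ν⟩) * star (W ⟨p.src, p.μ⟩ : Matrix (Fin 2) (Fin 2) ℂ))
            - (((W ⟨p.src, p.μ⟩ * W ⟨p.src.shift p.μ, p.ν⟩ * (W ⟨p.src.shift p.ν, p.μ⟩)⁻¹ : Matrix.specialUnitaryGroup (Fin 2) ℂ) : Matrix (Fin 2) (Fin 2) ℂ) * (Complex.I • D ⟨p.src.shift p.ν, p.μ⟩) * star ((W ⟨p.src, p.μ⟩ * W ⟨p.src.shift p.μ, p.ν⟩ * (W ⟨p.src.shift p.ν, p.μ⟩)⁻¹ : Matrix.specialUnitaryGroup (Fin 2) ℂ) : Matrix (Fin 2) (Fin 2) ℂ))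
            - (((GaugeField.plaqHol W p : Matrix.specialUnitaryGroup (Fin 2) ℂ) : Matrix (Fin 2) (Fin 2) ℂ) * (Complex.I • D ⟨p.src, p.ν⟩) * star ((GaugeField.plaqHol W p : Matrix.specialUnitaryGroup (Fin 2) ℂ) : Matrix (Fin 2) (Fin 2) ℂ)))‖ ^ 2) :
    wilsonAction4 W ≤ wilsonAction4 (emb15 W (expHermField D)) := by
  have he0 : 0 < e := pos_of_regPr F hreg
  have hthr0 : 0 ≤ regThreshold F n K e := by unfold regThreshold; positivity
  have ha : ∀ p : Plaq (F.P K) 0, ‖((GaugeField.plaqHol W p : Matrix.specialUnitaryGroup (Fin 2) ℂ) : Matrix (Fin 2) (Fin 2) ℂ) - 1‖ ≤ regThreshold F n K e := fun p => by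
    have hp := hreg.1 p
    rw [SU2Mean.dist1_eq_norm] at hp
    exact hp.le
  have hT := wilsonAction4_expChart_sub_lin_ge W D hDh hDs hs4 hthr0 ha (θ := 1 / 2) (by norm_num) (by norm_num)
  rw [show ((1 : ℝ) - 1 / 2) / 2 = 1 / 4 by norm_num, show (7776 : ℝ) * (1 / 2)⁻¹ = 15552 by norm_num] at hT
  have habs := neg_abs_le (∑ p : Plaq (F.P K) 0, (1 / 2) * (((((GaugeField.plaqHol W p : Matrix.specialUnitaryGroup (Fin 2) ℂ) : Matrix (Fin 2) (Fin 2) ℂ) - 1)ᴴ * (((Complex.I • D ⟨p.src, p.μ⟩) + ((W ⟨p.src, p.μ⟩ : Matrix (Fin 2) (Fin 2) ℂ) * (Complex.I • D ⟨p.src.shift p.μ, p.ν⟩) * star (W ⟨p.src, p.μ⟩ : Matrix (Fin 2) (Fin 2) ℂ))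
            - (((W ⟨p.src, p.μ⟩ * W ⟨p.src.shift p.μ, p.ν⟩ * (W ⟨p.src.shift p.ν, p.μ⟩)⁻¹ : Matrix.specialUnitaryGroup (Fin 2) ℂ) : Matrix (Fin 2) (Fin 2) ℂ) * (Complex.I • D ⟨p.src.shift p.ν, p.μ⟩) * star ((W ⟨p.src, p.μ⟩ * W ⟨p.src.shift p.μ, p.ν⟩ * (W ⟨p.src.shift p.ν, p.μ⟩)⁻¹ : Matrix.specialUnitaryGroup (Fin 2) ℂ) : Matrix (Fin 2) (Fin 2) ℂ))
            - (((GaugeField.plaqHol W p : Matrix.specialUnitaryGroup (Fin 2) ℂ) : Matrix (Fin 2) (Fin 2) ℂ) * (Complex.I • D ⟨p.src, p.ν⟩) * star ((GaugeField.plaqHol W p : Matrix.specialUnitaryGroup (Fin 2) ℂ) : Matrix (Fin 2) (Fin 2) ℂ))) * ((GaugeField.plaqHol W p : Matrix.specialUnitaryGroup (Fin 2) ℂ) : Matrix (Fin 2) (Fin 2) ℂ))).trace).re)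
  linarith [hT, habs, hlin]

/-- ★★ **E′ AT A DATUM FROM THE Lin-LEVEL ROWS.**  `W ∈ (6)(e) ∩ 𝔅_k(V)`; every competitor `W′ ∈ (6)(e) ∩ 𝔅_k(V)` carries a Hermitian-traceless `D` of sup-radius `s`, `4s ≤ 1`,
with `A(W′) = A(e^{iD}W)` and the Lin-level row of `wilsonAction4_le_expChart_of_linRow`.  Then `W` minimises the Wilson action over (6)(e) (criticality is the
supplier's input, not the door's). [cite: Balaban1985Variational, (141)-(142) p.299, (47)-(48) pp.285-286, (6) p.278] -/
theorem isMinOn_regFibrePr_of_linRows_at (h : n ≤ K) {e : ℝ}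
    (V : GaugeField (F.P n) 0 (Matrix.specialUnitaryGroup (Fin 2) ℂ)) {W : GaugeField (F.P K) 0 (Matrix.specialUnitaryGroup (Fin 2) ℂ)} (hWe : W ∈ regFibrePr F n K h e V)
    (hrows : ∀ W' : GaugeField (F.P K) 0 (Matrix.specialUnitaryGroup (Fin 2) ℂ), W' ∈ regFibrePr F n K h e V →
        ∃ (D : PBond (F.P K) 0 → Matrix (Fin 2) (Fin 2) ℂ) (s : ℝ),
          (∀ b : PBond (F.P K) 0, (D b).IsHermitian ∧ Matrix.trace (D b) = 0) ∧ (∀ b : PBond (F.P K) 0, ‖D b‖ ≤ s) ∧ 4 * s ≤ 1 ∧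
          wilsonAction4 W' = wilsonAction4 (emb15 W (expHermField D)) ∧
          |∑ p : Plaq (F.P K) 0, (1 / 2) * (((((GaugeField.plaqHol W p : Matrix.specialUnitaryGroup (Fin 2) ℂ) : Matrix (Fin 2) (Fin 2) ℂ) - 1)ᴴ * (((Complex.I • D ⟨p.src, p.μ⟩) + ((W ⟨p.src, p.μ⟩ : Matrix (Fin 2) (Fin 2) ℂ) * (Complex.I • D ⟨p.src.shift p.μ, p.ν⟩) * star (W ⟨p.src, p.μ⟩ : Matrix (Fin 2) (Fin 2) ℂ))
            - (((W ⟨p.src, p.μ⟩ * W ⟨p.src.shift p.μ, p.ν⟩ * (W ⟨p.src.shift p.ν, p.μ⟩)⁻¹ : Matrix.specialUnitaryGroup (Fin 2) ℂ) : Matrix (Fin 2) (Fin 2) ℂ) * (Complex.I • D ⟨p.src.shift p.ν, p.μ⟩) * star ((W ⟨p.src, p.μ⟩ * W ⟨p.src.shift p.μ, p.ν⟩ * (W ⟨p.src.shift p.ν, p.μ⟩)⁻¹ : Matrix.specialUnitaryGroup (Fin 2) ℂ) : Matrix (Fin 2) (Fin 2) ℂ))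
            - (((GaugeField.plaqHol W p : Matrix.specialUnitaryGroup (Fin 2) ℂ) : Matrix (Fin 2) (Fin 2) ℂ) * (Complex.I • D ⟨p.src, p.ν⟩) * star ((GaugeField.plaqHol W p : Matrix.specialUnitaryGroup (Fin 2) ℂ) : Matrix (Fin 2) (Fin 2) ℂ))) * ((GaugeField.plaqHol W p : Matrix.specialUnitaryGroup (Fin 2) ℂ) : Matrix (Fin 2) (Fin 2) ℂ))).trace).re|
              + (15552 * s ^ 2 + 216 * regThreshold F n K e) * ∑ b : PBond (F.P K) 0, ‖D b‖ ^ 2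
            ≤ 1 / 4 * ∑ p : Plaq (F.P K) 0, ‖((Complex.I • D ⟨p.src, p.μ⟩) + ((W ⟨p.src, p.μ⟩ : Matrix (Fin 2) (Fin 2) ℂ) * (Complex.I • D ⟨p.src.shift p.μ, p.ν⟩) * star (W ⟨p.src, p.μ⟩ : Matrix (Fin 2) (Fin 2) ℂ))
            - (((W ⟨p.src, p.μ⟩ * W ⟨p.src.shift p.μ, p.ν⟩ * (W ⟨p.src.shift p.ν, p.μ⟩)⁻¹ : Matrix.specialUnitaryGroup (Fin 2) ℂ) : Matrix (Fin 2) (Fin 2) ℂ) * (Complex.I • D ⟨p.src.shift p.ν, p.μ⟩) * star ((W ⟨p.src, p.μ⟩ * W ⟨p.src.shift p.μ, p.ν⟩ * (W ⟨p.src.shift p.ν, p.μ⟩)⁻¹ : Matrix.specialUnitaryGroup (Fin 2) ℂ) : Matrix (Fin 2) (Fin 2) ℂ))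
            - (((GaugeField.plaqHol W p : Matrix.specialUnitaryGroup (Fin 2) ℂ) : Matrix (Fin 2) (Fin 2) ℂ) * (Complex.I • D ⟨p.src, p.ν⟩) * star ((GaugeField.plaqHol W p : Matrix.specialUnitaryGroup (Fin 2) ℂ) : Matrix (Fin 2) (Fin 2) ℂ)))‖ ^ 2) :
    IsMinOn (fun W' : GaugeField (F.P K) 0 (Matrix.specialUnitaryGroup (Fin 2) ℂ) => wilsonAction4 W') (regFibrePr F n K h e V) W := by
  intro W' hW'
  obtain ⟨D, s, hDh, hDs, hs4, hA, hlin⟩ := hrows W' hW'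
  show wilsonAction4 W ≤ wilsonAction4 W'
  rw [hA]
  exact wilsonAction4_le_expChart_of_linRow F ((mem_regFibrePr_iff F).mp hWe).2 D hDh hDs hs4 hlin

/-- ★★ **THE Lin-LEVEL ROW FROM THE `Q`-CURRENCY PIECES** (★p1-19200 g13 2026-08-28 12:50Z (c)): if `|ℓ_W(D)| ≤ 2ε₀ℓ⁻¹·R` (the shape of
✓`abs_lin_le_sum_norm_trueLinIter`, `R = Σ_c‖(Q_W^{(K−n)} iD)(c)‖`), the remainder row `R ≤ C₁ℓ⁻¹·Σ‖D‖² + C₂ℓ·Σ_p‖ℒ_p(D)‖²`, HESS_W′ `κ·Σ‖D‖² ≤ Σ_p‖ℒ_p(D)‖²`, and the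
window `2ε₀C₂ ≤ ⅛`, `2ε₀C₁ℓ⁻² + 15552s² + 216·regThreshold(e) ≤ κ∕8` (`ℓ = L^{K−n}`), then the Lin-level row holds. Pure bookkeeping. [cite: Balaban1985Variational, (141)-(143) p.299, (116) p.295] -/
theorem linRow_of_QRows {e s ε₀ R C₁ C₂ κ : ℝ} (hε₀ : 0 ≤ ε₀) (W : GaugeField (F.P K) 0 (Matrix.specialUnitaryGroup (Fin 2) ℂ)) (D : PBond (F.P K) 0 → Matrix (Fin 2) (Fin 2) ℂ)
    (hELQ : |∑ p : Plaq (F.P K) 0, (1 / 2) * (((((GaugeField.plaqHol W p : Matrix.specialUnitaryGroup (Fin 2) ℂ) : Matrix (Fin 2) (Fin 2) ℂ) - 1)ᴴ * (((Complex.I • D ⟨p.src, p.μ⟩) + ((W ⟨p.src, p.μ⟩ : Matrix (Fin 2) (Fin 2) ℂ) * (Complex.I • D ⟨p.src.shift p.μ, p.ν⟩) * star (W ⟨p.src, p.μ⟩ : Matrix (Fin 2) (Fin 2) ℂ))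
            - (((W ⟨p.src, p.μ⟩ * W ⟨p.src.shift p.μ, p.ν⟩ * (W ⟨p.src.shift p.ν, p.μ⟩)⁻¹ : Matrix.specialUnitaryGroup (Fin 2) ℂ) : Matrix (Fin 2) (Fin 2) ℂ) * (Complex.I • D ⟨p.src.shift p.ν, p.μ⟩) * star ((W ⟨p.src, p.μ⟩ * W ⟨p.src.shift p.μ, p.ν⟩ * (W ⟨p.src.shift p.ν, p.μ⟩)⁻¹ : Matrix.specialUnitaryGroup (Fin 2) ℂ) : Matrix (Fin 2) (Fin 2) ℂ))
            - (((GaugeField.plaqHol W p : Matrix.specialUnitaryGroup (Fin 2) ℂ) : Matrix (Fin 2) (Fin 2) ℂ) * (Complex.I • D ⟨p.src, p.ν⟩) * star ((GaugeField.plaqHol W p : Matrix.specialUnitaryGroup (Fin 2) ℂ) : Matrix (Fin 2) (Fin 2) ℂ))) * ((GaugeField.plaqHol W p : Matrix.specialUnitaryGroup (Fin 2) ℂ) : Matrix (Fin 2) (Fin 2) ℂ))).trace).re| ≤ 2 * ε₀ * ((F.L : ℝ) ^ (K - n))⁻¹ * R)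
    (hR : R ≤ C₁ * ((F.L : ℝ) ^ (K - n))⁻¹ * ∑ b : PBond (F.P K) 0, ‖D b‖ ^ 2 + C₂ * (F.L : ℝ) ^ (K - n) * ∑ p : Plaq (F.P K) 0, ‖((Complex.I • D ⟨p.src, p.μ⟩) + ((W ⟨p.src, p.μ⟩ : Matrix (Fin 2) (Fin 2) ℂ) * (Complex.I • D ⟨p.src.shift p.μ, p.ν⟩) * star (W ⟨p.src, p.μ⟩ : Matrix (Fin 2) (Fin 2) ℂ))
            - (((W ⟨p.src, p.μ⟩ * W ⟨p.src.shift p.μ, p.ν⟩ * (W ⟨p.src.shift p.ν, p.μ⟩)⁻¹ : Matrix.specialUnitaryGroup (Fin 2) ℂ) : Matrix (Fin 2) (Fin 2) ℂ) * (Complex.I • D ⟨p.src.shift p.ν, p.μ⟩) * star ((W ⟨p.src, p.μ⟩ * W ⟨p.src.shift p.μ, p.ν⟩ * (W ⟨p.src.shift p.ν, p.μ⟩)⁻¹ : Matrix.specialUnitaryGroup (Fin 2) ℂ) : Matrix (Fin 2) (Fin 2) ℂ))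
            - (((GaugeField.plaqHol W p : Matrix.specialUnitaryGroup (Fin 2) ℂ) : Matrix (Fin 2) (Fin 2) ℂ) * (Complex.I • D ⟨p.src, p.ν⟩) * star ((GaugeField.plaqHol W p : Matrix.specialUnitaryGroup (Fin 2) ℂ) : Matrix (Fin 2) (Fin 2) ℂ)))‖ ^ 2)
    (hq : κ * ∑ b : PBond (F.P K) 0, ‖D b‖ ^ 2 ≤ ∑ p : Plaq (F.P K) 0, ‖((Complex.I • D ⟨p.src, p.μ⟩) + ((W ⟨p.src, p.μ⟩ : Matrix (Fin 2) (Fin 2) ℂ) * (Complex.I • D ⟨p.src.shift p.μ, p.ν⟩) * star (W ⟨p.src, p.μ⟩ : Matrix (Fin 2) (Fin 2) ℂ))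
            - (((W ⟨p.src, p.μ⟩ * W ⟨p.src.shift p.μ, p.ν⟩ * (W ⟨p.src.shift p.ν, p.μ⟩)⁻¹ : Matrix.specialUnitaryGroup (Fin 2) ℂ) : Matrix (Fin 2) (Fin 2) ℂ) * (Complex.I • D ⟨p.src.shift p.ν, p.μ⟩) * star ((W ⟨p.src, p.μ⟩ * W ⟨p.src.shift p.μ, p.ν⟩ * (W ⟨p.src.shift p.ν, p.μ⟩)⁻¹ : Matrix.specialUnitaryGroup (Fin 2) ℂ) : Matrix (Fin 2) (Fin 2) ℂ))
            - (((GaugeField.plaqHol W p : Matrix.specialUnitaryGroup (Fin 2) ℂ) : Matrix (Fin 2) (Fin 2) ℂ) * (Complex.I • D ⟨p.src, p.ν⟩) * star ((GaugeField.plaqHol W p : Matrix.specialUnitaryGroup (Fin 2) ℂ) : Matrix (Fin 2) (Fin 2) ℂ)))‖ ^ 2)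
    (hw₁ : 2 * ε₀ * C₂ ≤ 1 / 8)
    (hw₂ : 2 * ε₀ * C₁ * (((F.L : ℝ) ^ (K - n)) ^ 2)⁻¹ + 15552 * s ^ 2 + 216 * regThreshold F n K e ≤ κ / 8) :
    |∑ p : Plaq (F.P K) 0, (1 / 2) * (((((GaugeField.plaqHol W p : Matrix.specialUnitaryGroup (Fin 2) ℂ) : Matrix (Fin 2) (Fin 2) ℂ) - 1)ᴴ * (((Complex.I • D ⟨p.src, p.μ⟩) + ((W ⟨p.src, p.μ⟩ : Matrix (Fin 2) (Fin 2) ℂ) * (Complex.I • D ⟨p.src.shift p.μ, p.ν⟩) * star (W ⟨p.src, p.μ⟩ : Matrix (Fin 2) (Fin 2) ℂ))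
            - (((W ⟨p.src, p.μ⟩ * W ⟨p.src.shift p.μ, p.ν⟩ * (W ⟨p.src.shift p.ν, p.μ⟩)⁻¹ : Matrix.specialUnitaryGroup (Fin 2) ℂ) : Matrix (Fin 2) (Fin 2) ℂ) * (Complex.I • D ⟨p.src.shift p.ν, p.μ⟩) * star ((W ⟨p.src, p.μ⟩ * W ⟨p.src.shift p.μ, p.ν⟩ * (W ⟨p.src.shift p.ν, p.μ⟩)⁻¹ : Matrix.specialUnitaryGroup (Fin 2) ℂ) : Matrix (Fin 2) (Fin 2) ℂ))
            - (((GaugeField.plaqHol W p : Matrix.specialUnitaryGroup (Fin 2) ℂ) : Matrix (Fin 2) (Fin 2) ℂ) * (Complex.I • D ⟨p.src, p.ν⟩) * star ((GaugeField.plaqHol W p : Matrix.specialUnitaryGroup (Fin 2) ℂ) : Matrix (Fin 2) (Fin 2) ℂ))) * ((GaugeField.plaqHol W p : Matrix.specialUnitaryGroup (Fin 2) ℂ) : Matrix (Fin 2) (Fin 2) ℂ))).trace).re|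
        + (15552 * s ^ 2 + 216 * regThreshold F n K e) * ∑ b : PBond (F.P K) 0, ‖D b‖ ^ 2
      ≤ 1 / 4 * ∑ p : Plaq (F.P K) 0, ‖((Complex.I • D ⟨p.src, p.μ⟩) + ((W ⟨p.src, p.μ⟩ : Matrix (Fin 2) (Fin 2) ℂ) * (Complex.I • D ⟨p.src.shift p.μ, p.ν⟩) * star (W ⟨p.src, p.μ⟩ : Matrix (Fin 2) (Fin 2) ℂ))
            - (((W ⟨p.src, p.μ⟩ * W ⟨p.src.shift p.μ, p.ν⟩ * (W ⟨p.src.shift p.ν, p.μ⟩)⁻¹ : Matrix.specialUnitaryGroup (Fin 2) ℂ) : Matrix (Fin 2) (Fin 2) ℂ) * (Complex.I • D ⟨p.src.shift p.ν, p.μ⟩) * star ((W ⟨p.src, p.μ⟩ * W ⟨p.src.shift p.μ, p.ν⟩ * (W ⟨p.src.shift p.ν, p.μ⟩)⁻¹ : Matrix.specialUnitaryGroup (Fin 2) ℂ) : Matrix (Fin 2) (Fin 2) ℂ))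
            - (((GaugeField.plaqHol W p : Matrix.specialUnitaryGroup (Fin 2) ℂ) : Matrix (Fin 2) (Fin 2) ℂ) * (Complex.I • D ⟨p.src, p.ν⟩) * star ((GaugeField.plaqHol W p : Matrix.specialUnitaryGroup (Fin 2) ℂ) : Matrix (Fin 2) (Fin 2) ℂ)))‖ ^ 2 := by
  have hL1 : (1 : ℝ) ≤ (F.L : ℝ) := by have := F.hL.2; exact_mod_cast (by omega : 1 ≤ F.L)
  set ℓ : ℝ := (F.L : ℝ) ^ (K - n) with hℓ
  have hℓ1 : 1 ≤ ℓ := one_le_pow₀ hL1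
  have hℓ0 : 0 < ℓ := by linarith
  set M : ℝ := ∑ b : PBond (F.P K) 0, ‖D b‖ ^ 2 with hM
  set Kc : ℝ := ∑ p : Plaq (F.P K) 0, ‖((Complex.I • D ⟨p.src, p.μ⟩) + ((W ⟨p.src, p.μ⟩ : Matrix (Fin 2) (Fin 2) ℂ) * (Complex.I • D ⟨p.src.shift p.μ, p.ν⟩) * star (W ⟨p.src, p.μ⟩ : Matrix (Fin 2) (Fin 2) ℂ))
            - (((W ⟨p.src, p.μ⟩ * W ⟨p.src.shift p.μ, p.ν⟩ * (W ⟨p.src.shift p.ν, p.μ⟩)⁻¹ : Matrix.specialUnitaryGroup (Fin 2) ℂ) : Matrix (Fin 2) (Fin 2) ℂ) * (Complex.I • D ⟨p.src.shift p.ν, p.μ⟩) * star ((W ⟨p.src, p.μ⟩ * W ⟨p.src.shift p.μ, p.ν⟩ * (W ⟨p.src.shift p.ν, p.μ⟩)⁻¹ : Matrix.specialUnitaryGroup (Fin 2) ℂ) : Matrix (Fin 2) (Fin 2) ℂ))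
            - (((GaugeField.plaqHol W p : Matrix.specialUnitaryGroup (Fin 2) ℂ) : Matrix (Fin 2) (Fin 2) ℂ) * (Complex.I • D ⟨p.src, p.ν⟩) * star ((GaugeField.plaqHol W p : Matrix.specialUnitaryGroup (Fin 2) ℂ) : Matrix (Fin 2) (Fin 2) ℂ)))‖ ^ 2 with hKc
  have hM0 : 0 ≤ M := Finset.sum_nonneg fun _ _ => sq_nonneg _
  have hK0 : 0 ≤ Kc := Finset.sum_nonneg fun _ _ => sq_nonneg _
  have hco : 0 ≤ 2 * ε₀ * ℓ⁻¹ := by positivity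
  have h1 : |∑ p : Plaq (F.P K) 0, (1 / 2) * (((((GaugeField.plaqHol W p : Matrix.specialUnitaryGroup (Fin 2) ℂ) : Matrix (Fin 2) (Fin 2) ℂ) - 1)ᴴ * (((Complex.I • D ⟨p.src, p.μ⟩) + ((W ⟨p.src, p.μ⟩ : Matrix (Fin 2) (Fin 2) ℂ) * (Complex.I • D ⟨p.src.shift p.μ, p.ν⟩) * star (W ⟨p.src, p.μ⟩ : Matrix (Fin 2) (Fin 2) ℂ))
            - (((W ⟨p.src, p.μ⟩ * W ⟨p.src.shift p.μ, p.ν⟩ * (W ⟨p.src.shift p.ν, p.μ⟩)⁻¹ : Matrix.specialUnitaryGroup (Fin 2) ℂ) : Matrix (Fin 2) (Fin 2) ℂ) * (Complex.I • D ⟨p.src.shift p.ν, p.μ⟩) * star ((W ⟨p.src, p.μ⟩ * W ⟨p.src.shift p.μ, p.ν⟩ * (W ⟨p.src.shift p.ν, p.μ⟩)⁻¹ : Matrix.specialUnitaryGroup (Fin 2) ℂ) : Matrix (Fin 2) (Fin 2) ℂ))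
            - (((GaugeField.plaqHol W p : Matrix.specialUnitaryGroup (Fin 2) ℂ) : Matrix (Fin 2) (Fin 2) ℂ) * (Complex.I • D ⟨p.src, p.ν⟩) * star ((GaugeField.plaqHol W p : Matrix.specialUnitaryGroup (Fin 2) ℂ) : Matrix (Fin 2) (Fin 2) ℂ))) * ((GaugeField.plaqHol W p : Matrix.specialUnitaryGroup (Fin 2) ℂ) : Matrix (Fin 2) (Fin 2) ℂ))).trace).re| ≤ 2 * ε₀ * C₁ * (ℓ ^ 2)⁻¹ * M + 2 * ε₀ * C₂ * Kc := by
    have := hELQ.trans (mul_le_mul_of_nonneg_left hR hco)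
    have e1 : 2 * ε₀ * ℓ⁻¹ * (C₁ * ℓ⁻¹ * M + C₂ * ℓ * Kc) = 2 * ε₀ * C₁ * (ℓ ^ 2)⁻¹ * M + 2 * ε₀ * C₂ * Kc := by
      field_simp
    linarith [e1]
  have h2 : 2 * ε₀ * C₂ * Kc ≤ 1 / 8 * Kc := mul_le_mul_of_nonneg_right hw₁ hK0
  have h3 : (2 * ε₀ * C₁ * (ℓ ^ 2)⁻¹ + 15552 * s ^ 2 + 216 * regThreshold F n K e) * M ≤ κ / 8 * M := mul_le_mul_of_nonneg_right hw₂ hM0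
  nlinarith [h1, h2, h3, hq, hK0]

end Summit.QuantumFields.YangMills.Theorems.Prop7LocMinOfJointRow

end
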